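import Summits.Ventures.HodgeRepro0.P6AokiQuotientCard
import Summits.Ventures.HodgeRepro0.P6AokiQuotientLevel180

/-!
# The `Nat.card` corollary of the kernel certificate at the level 180

The committed general lemma `card_quotient_eq_two_pow` (P6AokiQuotientCard.lean) applied to
parts (2)–(3) of the kernel certificate `L180.main` (P6AokiQuotientLevel180.lean): the quotient
`B_180 / (S_180 + D_180)` has exactly `2 ^ 3 = 8` elements at `q = 180 = 4·9·5`, the same one-line
pattern as the thirteen levels of P6AokiQuotientCardLevels.lean / P6AokiQuotientCardLevels2.lean.
Record-only (R-5 / R-17): a supporting artefact, nothing on the Hodge conjecture at any degree.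
-/

namespace HodgeRepro0.P6AokiQuotient

/-- LEVEL 180 = 4·9·5: `|B_180 / (S_180 + D_180)| = 2^3`, from parts (2)–(3) of `L180.main`. -/
theorem L180.card : Nat.card (B 180 ⧸ (SD 180).comap (B 180).subtype) = 2 ^ 3 :=
  card_quotient_eq_two_pow _ L180.main.2.1 L180.main.2.2.1

end HodgeRepro0.P6AokiQuotient
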